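import Summits.CriticalPhenomena.PercolationContinuityZ3.Theorems.PercNearOneGluingNoHeavyLowerTailSuperTerminalDownsets
import Summits.CriticalPhenomena.PercolationContinuityZ3.Theorems.PercNearOneGluingNoHeavyLowerTailSuperTerminalDownsetEvents
import Summits.CriticalPhenomena.PercolationContinuityZ3.Theorems.PercNearOneGluingNoHeavyLowerTailSuperTerminalP3LamStable
import HarnessLib

/-!
# THEOREM C′ in down-set coordinates, the face inequality of every weighted graph, and the splitting formula for partial unions

Support file for crux `stmt-CriticalPhenomena-4575` (`NoHeavyLowerTail`), seat `prim-l12-p1` gen 32 (`--supports stmt-CriticalPhenomena-4575`);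
graph-level assembly of THEOREM C′ (`P3_λ`, `λ ≥ 8/5`, reduces to `{s,a,b,c}`-primes), part 1 of 2 (part 2: `…SuperTerminalP3LamGluing`).
No definitions, no sorries, standard axioms.

THE ROWS.  Bond percolation `μ = prodBernoulli w` on a finite vertex type `V`, pairwise distinct terminals `s a b c`; `F = {s↔a} ∩ {s↮b}`,
`I = c ∤ {s,a,b}`.  The reverse-Harris row `P3_λ` is `μ(F)·μ(c ↔ {s,a,b}) ≤ λ·μ(F ∩ c ↔ {s,a,b})` (`λ = 2` is the face row `P3½`; the
conjectured sharp constant is `λ = 3/2`).  THEOREM C′ (`SuperTerminalP3LamStable.p3lam_stable`, this seat gen 31): for every `λ ≥ 8/5` the row is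
stable under parallel composition at `{s,a,b,c}` modulo the 3-point face inequality `(C½)` of the `s–a`-glued pieces.

In the down-set coordinates `dk(u)` of parts 1–2 of the assembly (`…SuperTerminalDownsets`, `…SuperTerminalDownsetEvents`) this file proves:
* `dvec_core_mul` — the order relations of a partition law are closed under coordinatewise products;
* `dvec_p3lam_mul` — `p3lam_stable` in down-set coordinates: order relations + `P3_λ` + face inequality for two vectors ⟹ `P3_λ` for the product;
* `face_of_weight` — **for EVERY weight** the face inequality of the `sa`-glued graph, `2(d2+d4−d1)(1−d7) ≤ 3(d2+d4−2d1)`, from the sextic law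
  `sextic_law` and `ThreePointIsoSexticFace.face_half_of_isoSexticPort'`; `core_of_weight`, `rowLam_iff` (event form ⟺ down-set form);
* `real_F_mul_conn_single` — a one-pair graph has `μ(F)·μ(c↔T) = 0`, hence satisfies every row `P3_λ`;
* `real_partLE_partialUnion` — the splitting formula for the PARTIAL UNION `w_S := w·1_{terminal pairs ∪ pieces of S}` of a splitting
  [BeicheltTittmann2012, Thm. 7.5]: `P_{w_S}(π|_T ≤ blk) = P_{w₀}(π|_T ≤ blk) · ∏_{i∈S} P_{wᵢ}(π|_T ≤ blk)` (so every partial product of down-set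
  vectors in the assembly is the vector of an actual weighted graph, and inherits its face inequality).
-/

namespace Summit.CriticalPhenomena.PercolationContinuityZ3.Theorems.SuperTerminalP3LamDvec

open MeasureTheory Set
open Literature.Probability.Percolation Literature.Probability.Percolation.PartitionGluing
open Literature.Probability.LatticeModels (prodBernoulli)
open SuperTerminalDownsets SuperTerminalDownsetEvents SuperTerminalP3LamStable
open scoped Classical

variable {V : Type*} [Fintype V]
/-- The ORDER RELATIONS of a down-set vector `(x0,…,x7) = (D(s|a|b|c), D(sa|b|c), D(sa|bc), D(s|a|bc), D(sac|b), D(sc|a|b), D(ac|s|b), D(c|sab))`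
(cells of the 4-point partition law nonnegative, `γ ≤ 1`).  Local notation only. -/
local notation "Core[" x0 "," x1 "," x2 "," x3 "," x4 "," x5 "," x6 "," x7 "]" =>
  (((0 : ℝ) ≤ x0 ∧ x0 ≤ x1 ∧ x0 ≤ x3 ∧ x0 ≤ x5 ∧ x0 ≤ x6 ∧ (0 : ℝ) ≤ x7 ∧ x7 ≤ 1 ∧
      (0 : ℝ) ≤ x2 - x3 - x1 + x0 ∧ (0 : ℝ) ≤ x4 - x5 - x6 + x0 - x1 + x0) : Prop)

/-- The row `P3_λ` in down-set coordinates: `μ(F)(1 − γ) ≤ λ·μ(F ∩ c↔T)`.  Local notation only. -/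
local notation "RowLam[" lam ";" x0 "," x1 "," x2 "," x3 "," x4 "," x5 "," x6 "," x7 "]" =>
  (((x2 - x3 + x4 - x5 - x6 - x1 + 2 * x0) * (1 - x7) ≤ lam * (x2 - x3 + x4 - x5 - x6 - 2 * x1 + 3 * x0)) : Prop)

/-- The face inequality `(C½)` of the `sa`-glued graph at the port `c`, in down-set coordinates: `2(d2+d4−d1)(1−d7) ≤ 3(d2+d4−2d1)`.  Local notation only. -/
local notation "Face[" x1 "," x2 "," x4 "," x7 "]" => ((2 * (x2 + x4 - x1) * (1 - x7) ≤ 3 * (x2 + x4 - 2 * x1)) : Prop)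

/-! ## Cell algebra in down-set coordinates -/

/-- **The order relations are closed under coordinatewise products.** [this work] -/
theorem dvec_core_mul {d0 d1 d2 d3 d4 d5 d6 d7 e0 e1 e2 e3 e4 e5 e6 e7 : ℝ}
    (hd : Core[d0, d1, d2, d3, d4, d5, d6, d7]) (he : Core[e0, e1, e2, e3, e4, e5, e6, e7]) :
    Core[d0 * e0, d1 * e1, d2 * e2, d3 * e3, d4 * e4, d5 * e5, d6 * e6, d7 * e7] := by
  obtain ⟨h0, h1, h3, h5, h6, h7, h71, hζ, hτ⟩ := hd
  obtain ⟨g0, g1, g3, g5, g6, g7, g71, gζ, gτ⟩ := he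
  have hd1 : 0 ≤ d1 := h0.trans h1
  refine ⟨by positivity, mul_le_mul h1 g1 g0 hd1, mul_le_mul h3 g3 g0 (h0.trans h3), mul_le_mul h5 g5 g0 (h0.trans h5),
    mul_le_mul h6 g6 g0 (h0.trans h6), by positivity, ?_, ?_, ?_⟩
  · calc d7 * e7 ≤ 1 * 1 := mul_le_mul h71 g71 g7 zero_le_one
      _ = 1 := by ring
  · have hA : d1 - d0 ≤ d2 - d3 := by linarith
    have gA : e1 - e0 ≤ e2 - e3 := by linarith
    have hQ : 0 ≤ d1 - d0 := by linarith
    have gQ : 0 ≤ e1 - e0 := by linarith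
    have k1 := mul_le_mul hA gA gQ (hQ.trans hA)
    have k2 := mul_le_mul hA g3 g0 (hQ.trans hA)
    have k3 := mul_le_mul h3 gA gQ (h0.trans h3)
    have e : d2 * e2 - d3 * e3 - d1 * e1 + d0 * e0 =
        ((d2 - d3) * (e2 - e3) - (d1 - d0) * (e1 - e0)) + ((d2 - d3) * e3 - (d1 - d0) * e0) + (d3 * (e2 - e3) - d0 * (e1 - e0)) := by ring
    rw [e]
    have s1 : 0 ≤ (d2 - d3) * (e2 - e3) - (d1 - d0) * (e1 - e0) := by linarith
    have s2 : 0 ≤ (d2 - d3) * e3 - (d1 - d0) * e0 := by linarith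
    have s3 : 0 ≤ d3 * (e2 - e3) - d0 * (e1 - e0) := by linarith
    positivity
  · have hB : d1 - d0 ≤ d4 - d5 - d6 + d0 := by linarith
    have gB : e1 - e0 ≤ e4 - e5 - e6 + e0 := by linarith
    have hQ : 0 ≤ d1 - d0 := by linarith
    have gQ : 0 ≤ e1 - e0 := by linarith
    have hW : d0 ≤ d5 + d6 - d0 := by linarith
    have gW : e0 ≤ e5 + e6 - e0 := by linarith
    have k1 := mul_le_mul hB gB gQ (hQ.trans hB)
    have k2 := mul_le_mul hB gW g0 (hQ.trans hB)
    have k3 := mul_le_mul hW gB gQ (h0.trans hW)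
    have x1 : 0 ≤ (d5 - d0) * (e6 - e0) := mul_nonneg (by linarith) (by linarith)
    have x2 : 0 ≤ (d6 - d0) * (e5 - e0) := mul_nonneg (by linarith) (by linarith)
    have e : d4 * e4 - d5 * e5 - d6 * e6 + d0 * e0 - d1 * e1 + d0 * e0 =
        (((d4 - d5 - d6 + d0) * (e4 - e5 - e6 + e0) - (d1 - d0) * (e1 - e0)) + ((d4 - d5 - d6 + d0) * (e5 + e6 - e0) - (d1 - d0) * e0) +
        ((d5 + d6 - d0) * (e4 - e5 - e6 + e0) - d0 * (e1 - e0))) + ((d5 - d0) * (e6 - e0) + (d6 - d0) * (e5 - e0)) := by ring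
    rw [e]
    have s1 : 0 ≤ (d4 - d5 - d6 + d0) * (e4 - e5 - e6 + e0) - (d1 - d0) * (e1 - e0) := by linarith
    have s2 : 0 ≤ (d4 - d5 - d6 + d0) * (e5 + e6 - e0) - (d1 - d0) * e0 := by linarith
    have s3 : 0 ≤ (d5 + d6 - d0) * (e4 - e5 - e6 + e0) - d0 * (e1 - e0) := by linarith
    positivity

/-- **THEOREM C′ in down-set coordinates**: for `λ ≥ 8/5`, if two down-set vectors satisfy the order relations, the row `P3_λ` and the face
inequality, then their coordinatewise product satisfies the row `P3_λ` (`SuperTerminalP3LamStable.p3lam_stable`). [this work] -/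
theorem dvec_p3lam_mul {lam d0 d1 d2 d3 d4 d5 d6 d7 e0 e1 e2 e3 e4 e5 e6 e7 : ℝ} (hlam : 8 / 5 ≤ lam)
    (hd : Core[d0, d1, d2, d3, d4, d5, d6, d7]) (hP : RowLam[lam; d0, d1, d2, d3, d4, d5, d6, d7]) (hF : Face[d1, d2, d4, d7])
    (he : Core[e0, e1, e2, e3, e4, e5, e6, e7]) (gP : RowLam[lam; e0, e1, e2, e3, e4, e5, e6, e7]) (gF : Face[e1, e2, e4, e7]) :
    RowLam[lam; d0 * e0, d1 * e1, d2 * e2, d3 * e3, d4 * e4, d5 * e5, d6 * e6, d7 * e7] := by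
  obtain ⟨h0, h1, h3, h5, h6, h7, h71, hζ, hτ⟩ := hd
  obtain ⟨g0, g1, g3, g5, g6, g7, g71, gζ, gτ⟩ := he
  have T := p3lam_stable (lam := lam) (n := d0) (σ := d1 - d0) (ζ := d2 - d3 - d1 + d0) (β := d3 - d0) (ξs := d5 - d0) (ξa := d6 - d0)
    (τ := d4 - d5 - d6 + d0 - d1 + d0) (γ := d7)
    (n' := e0) (σ' := e1 - e0) (ζ' := e2 - e3 - e1 + e0) (β' := e3 - e0) (ξs' := e5 - e0) (ξa' := e6 - e0)
    (τ' := e4 - e5 - e6 + e0 - e1 + e0) (γ' := e7) hlam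
    h0 (by linarith) hζ (by linarith) (by linarith) (by linarith) hτ h7 h71
    g0 (by linarith) gζ (by linarith) (by linarith) (by linarith) gτ g7 g71
    (by convert hP using 2 <;> ring) (by convert hF using 2 <;> ring) (by convert gP using 2 <;> ring) (by convert gF using 2 <;> ring)
  convert T using 2 <;> ring

/-! ## The laws of every weighted graph in down-set coordinates -/

section Weight
variable {s a b c : V}

/-- **The face inequality `(C½)` of the `sa`-glued graph holds for every weight**, in down-set coordinates: `2(d2+d4−d1)(1−d7) ≤ 3(d2+d4−2d1)`
— from the sextic law of every weight (`sextic_law`) and the cell lemma `ThreePointIsoSexticFace.face_half_of_isoSexticPort'`. [this work] -/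
theorem face_of_weight (u : Sym2 V → unitInterval) (hd : s ≠ a ∧ s ≠ b ∧ s ≠ c ∧ a ≠ b ∧ a ≠ c ∧ b ≠ c) :
    Face[(prodBernoulli u).real ((openConn s b)ᶜ ∩ (openConn s c)ᶜ ∩ (openConn a b)ᶜ ∩ (openConn a c)ᶜ ∩ (openConn b c)ᶜ),
      (prodBernoulli u).real ((openConn s b)ᶜ ∩ (openConn s c)ᶜ ∩ (openConn a b)ᶜ ∩ (openConn a c)ᶜ),
      (prodBernoulli u).real ((openConn s b)ᶜ ∩ (openConn a b)ᶜ ∩ (openConn b c)ᶜ),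
      (prodBernoulli u).real ((openConn c s)ᶜ ∩ (openConn c a)ᶜ ∩ (openConn c b)ᶜ)] := by
  have h6 := sextic_law u hd
  set d1 := (prodBernoulli u).real ((openConn s b)ᶜ ∩ (openConn s c)ᶜ ∩ (openConn a b)ᶜ ∩ (openConn a c)ᶜ ∩ (openConn b c)ᶜ)
  set d2 := (prodBernoulli u).real ((openConn s b)ᶜ ∩ (openConn s c)ᶜ ∩ (openConn a b)ᶜ ∩ (openConn a c)ᶜ)
  set d4 := (prodBernoulli u).real ((openConn s b)ᶜ ∩ (openConn a b)ᶜ ∩ (openConn b c)ᶜ)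
  set d7 := (prodBernoulli u).real ((openConn c s)ᶜ ∩ (openConn c a)ᶜ ∩ (openConn c b)ᶜ)
  have hd1 : 0 ≤ d1 := measureReal_nonneg
  have h12 : d1 ≤ d2 := measureReal_mono inter_subset_left
  have h14 : d1 ≤ d4 := measureReal_mono (by rintro ω ⟨⟨⟨⟨h1, -⟩, h3⟩, -⟩, h5⟩; exact ⟨⟨h1, h3⟩, h5⟩)
  have h17 : d1 ≤ d7 := measureReal_mono (by
    rintro ω ⟨⟨⟨⟨-, h2⟩, -⟩, h4⟩, h5⟩
    exact ⟨⟨fun h => h2 (LonePortSum.mem_openConn_symm h), fun h => h4 (LonePortSum.mem_openConn_symm h)⟩,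
      fun h => h5 (LonePortSum.mem_openConn_symm h)⟩)
  have hface := ThreePointIsoSexticFace.face_half_of_isoSexticPort' (q := d1) (s := d7 - d1) (t := d4 - d1) (u := d2 - d1)
    hd1 (sub_nonneg.2 h17) (sub_nonneg.2 h14) (sub_nonneg.2 h12) (by
      have e : (d1 + (d2 - d1)) ^ 3 * (d1 + (d4 - d1)) ^ 3 * (d1 + (d7 - d1)) ^ 2 = d7 ^ 2 * d2 ^ 3 * d4 ^ 3 := by ring
      rw [e]; exact h6)
  nlinarith [hface]

/-- The order relations hold for every weight (part 2 `order_relations`). [this work] -/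
theorem core_of_weight (u : Sym2 V → unitInterval) (s a b c : V) :
    Core[(prodBernoulli u).real ((openConn s a)ᶜ ∩ (openConn s b)ᶜ ∩ (openConn s c)ᶜ ∩ (openConn a b)ᶜ ∩ (openConn a c)ᶜ ∩ (openConn b c)ᶜ),
      (prodBernoulli u).real ((openConn s b)ᶜ ∩ (openConn s c)ᶜ ∩ (openConn a b)ᶜ ∩ (openConn a c)ᶜ ∩ (openConn b c)ᶜ),
      (prodBernoulli u).real ((openConn s b)ᶜ ∩ (openConn s c)ᶜ ∩ (openConn a b)ᶜ ∩ (openConn a c)ᶜ),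
      (prodBernoulli u).real ((openConn s a)ᶜ ∩ (openConn s b)ᶜ ∩ (openConn s c)ᶜ ∩ (openConn a b)ᶜ ∩ (openConn a c)ᶜ),
      (prodBernoulli u).real ((openConn s b)ᶜ ∩ (openConn a b)ᶜ ∩ (openConn b c)ᶜ),
      (prodBernoulli u).real ((openConn s a)ᶜ ∩ (openConn s b)ᶜ ∩ (openConn a b)ᶜ ∩ (openConn a c)ᶜ ∩ (openConn b c)ᶜ),
      (prodBernoulli u).real ((openConn s a)ᶜ ∩ (openConn s b)ᶜ ∩ (openConn s c)ᶜ ∩ (openConn a b)ᶜ ∩ (openConn b c)ᶜ),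
      (prodBernoulli u).real ((openConn c s)ᶜ ∩ (openConn c a)ᶜ ∩ (openConn c b)ᶜ)] := by
  obtain ⟨o1, o3, o5, o6, o71, oζ, oτ⟩ := order_relations u s a b c
  exact ⟨measureReal_nonneg, o1, o3, o5, o6, measureReal_nonneg, o71, oζ, oτ⟩

/-- `P3_λ` at the event level is the row in down-set coordinates (part 2: `real_F`, `real_F_inter_conn`, `real_conn`). [this work] -/
theorem rowLam_iff (u : Sym2 V → unitInterval) (lam : ℝ) (s a b c : V) :
    (prodBernoulli u).real (openConn s a ∩ (openConn s b)ᶜ : Set (BondConfig V)) *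
        (prodBernoulli u).real ((openConn c s)ᶜ ∩ (openConn c a)ᶜ ∩ (openConn c b)ᶜ : Set (BondConfig V))ᶜ ≤
      lam * (prodBernoulli u).real (openConn s a ∩ (openConn s b)ᶜ ∩ ((openConn c s)ᶜ ∩ (openConn c a)ᶜ ∩ (openConn c b)ᶜ)ᶜ : Set (BondConfig V)) ↔
    RowLam[lam; (prodBernoulli u).real ((openConn s a)ᶜ ∩ (openConn s b)ᶜ ∩ (openConn s c)ᶜ ∩ (openConn a b)ᶜ ∩ (openConn a c)ᶜ ∩ (openConn b c)ᶜ),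
      (prodBernoulli u).real ((openConn s b)ᶜ ∩ (openConn s c)ᶜ ∩ (openConn a b)ᶜ ∩ (openConn a c)ᶜ ∩ (openConn b c)ᶜ),
      (prodBernoulli u).real ((openConn s b)ᶜ ∩ (openConn s c)ᶜ ∩ (openConn a b)ᶜ ∩ (openConn a c)ᶜ),
      (prodBernoulli u).real ((openConn s a)ᶜ ∩ (openConn s b)ᶜ ∩ (openConn s c)ᶜ ∩ (openConn a b)ᶜ ∩ (openConn a c)ᶜ),
      (prodBernoulli u).real ((openConn s b)ᶜ ∩ (openConn a b)ᶜ ∩ (openConn b c)ᶜ),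
      (prodBernoulli u).real ((openConn s a)ᶜ ∩ (openConn s b)ᶜ ∩ (openConn a b)ᶜ ∩ (openConn a c)ᶜ ∩ (openConn b c)ᶜ),
      (prodBernoulli u).real ((openConn s a)ᶜ ∩ (openConn s b)ᶜ ∩ (openConn s c)ᶜ ∩ (openConn a b)ᶜ ∩ (openConn b c)ᶜ),
      (prodBernoulli u).real ((openConn c s)ᶜ ∩ (openConn c a)ᶜ ∩ (openConn c b)ᶜ)] := by
  rw [real_F u s a b c, real_F_inter_conn u s a b c, real_conn u s a b c]
  constructor
  · intro h; linear_combination h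
  · intro h; linear_combination h

/-- **A one-pair graph satisfies every row `P3_λ`, `λ ≥ 0`**: for `u = w·1_{e}`, `μ(F)·μ(c ↔ T) = 0` (if `e = s(s,a)` the port is a.s. isolated,
otherwise `μ(F) ≤ μ(s↔a) = 0`; part 2 `real_openConn_eq_zero_of_single`). [this work] -/
theorem real_F_mul_conn_single (w : Sym2 V → unitInterval) (hd : s ≠ a ∧ s ≠ b ∧ s ≠ c ∧ a ≠ b ∧ a ≠ c ∧ b ≠ c) (e : Sym2 V) :
    (prodBernoulli fun e' => if e' = e then w e' else 0).real (openConn s a ∩ (openConn s b)ᶜ : Set (BondConfig V)) *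
      (prodBernoulli fun e' => if e' = e then w e' else 0).real ((openConn c s)ᶜ ∩ (openConn c a)ᶜ ∩ (openConn c b)ᶜ : Set (BondConfig V))ᶜ = 0 := by
  set u : Sym2 V → unitInterval := fun e' => if e' = e then w e' else 0 with hu_def
  have hu : ∀ e', e' ≠ e → (u e' : ℝ) = 0 := fun e' h => by simp [hu_def, h]
  by_cases hsa : s(s, a) = e
  · have hcs : (prodBernoulli u).real (openConn c s) = 0 :=
      real_openConn_eq_zero_of_single u e hu (Ne.symm hd.2.2.1) (by
        rw [← hsa]; intro h
        rcases Sym2.eq_iff.1 h with ⟨h1, -⟩ | ⟨h1, -⟩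
        · exact hd.2.2.1 h1.symm
        · exact hd.2.2.2.2.1 h1.symm)
    have hca : (prodBernoulli u).real (openConn c a) = 0 :=
      real_openConn_eq_zero_of_single u e hu (Ne.symm hd.2.2.2.2.1) (by
        rw [← hsa]; intro h
        rcases Sym2.eq_iff.1 h with ⟨h1, -⟩ | ⟨-, h2⟩
        · exact hd.2.2.1 h1.symm
        · exact hd.1 h2.symm)
    have hcb : (prodBernoulli u).real (openConn c b) = 0 :=
      real_openConn_eq_zero_of_single u e hu (Ne.symm hd.2.2.2.2.2) (by
        rw [← hsa]; intro h
        rcases Sym2.eq_iff.1 h with ⟨h1, -⟩ | ⟨-, h2⟩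
        · exact hd.2.2.1 h1.symm
        · exact hd.2.1 h2.symm)
    have hI : (prodBernoulli u).real ((openConn c s)ᶜ ∩ (openConn c a)ᶜ ∩ (openConn c b)ᶜ : Set (BondConfig V))ᶜ = 0 := by
      refine le_antisymm ?_ measureReal_nonneg
      have hsub : ((openConn c s)ᶜ ∩ (openConn c a)ᶜ ∩ (openConn c b)ᶜ : Set (BondConfig V))ᶜ ⊆
          (openConn c s ∪ openConn c a) ∪ openConn c b := by
        intro ω hω
        simp only [mem_compl_iff, mem_inter_iff, not_and, not_not, mem_union] at hω ⊢
        tauto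
      calc (prodBernoulli u).real ((openConn c s)ᶜ ∩ (openConn c a)ᶜ ∩ (openConn c b)ᶜ : Set (BondConfig V))ᶜ
          ≤ (prodBernoulli u).real ((openConn c s ∪ openConn c a) ∪ openConn c b) := measureReal_mono hsub
        _ ≤ (prodBernoulli u).real (openConn c s ∪ openConn c a) + (prodBernoulli u).real (openConn c b) := measureReal_union_le _ _
        _ ≤ (prodBernoulli u).real (openConn c s) + (prodBernoulli u).real (openConn c a) + (prodBernoulli u).real (openConn c b) :=
            add_le_add (measureReal_union_le _ _) le_rfl
        _ = 0 := by rw [hcs, hca, hcb]; ring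
    rw [hI, mul_zero]
  · have hF : (prodBernoulli u).real (openConn s a ∩ (openConn s b)ᶜ : Set (BondConfig V)) = 0 :=
      le_antisymm ((measureReal_mono inter_subset_left).trans
        (real_openConn_eq_zero_of_single u e hu hd.1 hsa).le) measureReal_nonneg
    rw [hF, zero_mul]

end Weight

/-! ## The splitting formula for partial unions of pieces -/

section PartialUnion
variable {ι : Type*} [Fintype ι] {κ : Type*}

/-- **Splitting formula for a partial union.**  For a splitting `part` of `w` along `T` and a set `S` of labels, the weighted graph
`w_S := w·1_{terminal pairs ∪ pieces of S}` has `P_{w_S}(π|_T ≤ blk) = P_{w₀}(π|_T ≤ blk) · ∏_{i ∈ S} P_{wᵢ}(π|_T ≤ blk)`: it is itself a splitting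
whose pieces are `wᵢ` (`i ∈ S`) and empty graphs. [cite: BeicheltTittmann2012, Thm. 7.5 ((7.4); Exercise 7.1), down-set form] -/
theorem real_partLE_partialUnion (w : Sym2 V → unitInterval) (T : Finset V) (part : V → ι)
    (hw : ∀ x y : V, x ∉ T → y ∉ T → part x ≠ part y → (w s(x, y) : ℝ) = 0) (S : Finset ι) (blk : V → κ) :
    (prodBernoulli fun e => if e ∈ T.sym2 ∨ ∃ i ∈ S, e ∈ piecePairs T part i then w e else 0).real (partLE T blk) =
      (prodBernoulli fun e => if e ∈ T.sym2 then w e else 0).real (partLE T blk) *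
        ∏ i ∈ S, (prodBernoulli fun e => if e ∈ piecePairs T part i then w e else 0).real (partLE T blk) := by
  set wS : Sym2 V → unitInterval := fun e => if e ∈ T.sym2 ∨ ∃ i ∈ S, e ∈ piecePairs T part i then w e else 0 with hwS
  have hwS' : ∀ x y : V, x ∉ T → y ∉ T → part x ≠ part y → (wS s(x, y) : ℝ) = 0 := by
    intro x y hx hy hxy
    by_cases h : s(x, y) ∈ T.sym2 ∨ ∃ i ∈ S, s(x, y) ∈ piecePairs T part i
    · have : (wS s(x, y) : ℝ) = w s(x, y) := by simp only [hwS, if_pos h]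
      rw [this]; exact hw x y hx hy hxy
    · simp only [hwS, if_neg h]; rfl
  rw [real_partLE_eq_terminalPiece_mul_prod wS T part blk hwS']
  -- the terminal piece of `w_S` is `w₀`
  have happ : ∀ e, wS e = if e ∈ T.sym2 ∨ ∃ i ∈ S, e ∈ piecePairs T part i then w e else 0 := fun e => rfl
  have h0 : (fun e => if e ∈ T.sym2 then wS e else 0) = fun e => if e ∈ T.sym2 then w e else 0 := by
    funext e
    by_cases he : e ∈ T.sym2
    · rw [if_pos he, if_pos he, happ, if_pos (Or.inl he)]
    · rw [if_neg he, if_neg he]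
  -- the pieces of `w_S`
  have hi : ∀ i, (fun e => if e ∈ piecePairs T part i then wS e else 0) =
      if i ∈ S then (fun e => if e ∈ piecePairs T part i then w e else 0) else fun _ => 0 := by
    intro i
    by_cases hiS : i ∈ S
    · rw [if_pos hiS]
      funext e
      by_cases he : e ∈ piecePairs T part i
      · rw [if_pos he, if_pos he, happ, if_pos (Or.inr ⟨i, hiS, he⟩)]
      · rw [if_neg he, if_neg he]
    · rw [if_neg hiS]
      funext e
      by_cases he : e ∈ piecePairs T part i
      · have hne : ¬ (e ∈ T.sym2 ∨ ∃ i ∈ S, e ∈ piecePairs T part i) := by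
          rintro (hT | ⟨j, hjS, hj⟩)
          · obtain ⟨u, v, ⟨hu, -⟩, -, -, rfl⟩ := mem_piecePairs.1 he
            exact hu (Finset.mk_mem_sym2_iff.1 hT).1
          · have hij : i = j := by
              by_contra hij
              exact Finset.disjoint_left.1 (pairwiseDisjoint_piecePairs T part (Finset.mem_coe.2 (Finset.mem_univ i))
                (Finset.mem_coe.2 (Finset.mem_univ j)) hij) he hj
            exact hiS (hij ▸ hjS)
        rw [if_pos he, happ, if_neg hne]
      · rw [if_neg he]
  rw [h0]
  congr 1
  rw [← Finset.univ_inter S, ← Finset.prod_ite_mem]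
  refine Finset.prod_congr rfl fun i _ => ?_
  rw [hi i]
  split_ifs with hiS
  · rfl
  · exact real_partLE_zero T blk

end PartialUnion

end Summit.CriticalPhenomena.PercolationContinuityZ3.Theorems.SuperTerminalP3LamDvec
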